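import Literature.AlgebraicGeometry.AbelianSchemes.AbelianSchemeQuotientDescentCharacter
import Literature.AlgebraicGeometry.AbelianSchemes.AbelianSchemeQuotientMulNDescent
import Literature.AlgebraicGeometry.AbelianSchemes.AbelianSchemeSteinOfNoetherian
import HarnessLib

/-!
# The character of an action over `[n]_A` on a module killed by `[n]_A^*` (towards the pairing `e_n(σ, c)`)

Layer `Literature/AlgebraicGeometry/AbelianSchemes`, namespace `Literature.AlgebraicGeometry.AbelianSchemes.AbelianSchemeOver.MulNCharacter`.
THEOREMS ONLY (no definition, no named fact, no instance, no `sorry`).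

Setting ([MumfordAV1970] §7 Thm. 4, §12 Thm. 1, §15 Thm. 1, §20 p. 184): `A/S` an abelian scheme over a locally Noetherian base, a
group `K` acting on the total space `A` OVER the multiplication `[n]_A : A → A` (`ρ : ActionOver (A.mulN n).left K` — e.g. the
translations `t_σ` by a finite group of `n`-torsion sections, `t_σ ≫ [n] = [n]`, ★ `aut_hom_comp_mulN_left`; the action is a
VARIABLE here so that consumers instantiate it once, the «variable action» junction of ★ `AbelianSchemeQuotientDescentCharacter` §0),
and a module `L` on `A` whose pull-back `[n]^* L` is TRIVIAL, `τ : [n]^* L ≅ 𝒪_A` (e.g. `L = (1 × c)^*𝒫` for an `n`-torsion point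
`c` of the dual, ★ (K1) `PoincareSheafMulNKernel`).  The canonical `K`-linearisation of `[n]^* L` (★ `EquivariantStructure.ofPullback`)
acts on its sections, and the generator `s := τ⁻¹(1)` is an EIGEN-SECTION: `g · s = a_g · s` with `a_g ∈ Γ(A, 𝒪_A) = Γ(S, 𝒪_S)`
(Stein, ★ `AbelianSchemeSteinOfNoetherian`).  This is [MumfordAV1970] §20's construction of `e_n` (p. 184: «the action of translation
by points of `X_n` on `n_X^* L`, `L ∈ Pic⁰` of order `n`, is through a character»), written for a variable action; the file is ★
`AbelianSchemeQuotientDescentCharacter` §1 TRANSPOSED from the quotient `ψ_T : A_T → (A/K)_T` to `[n]_A : A → A`.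

* §1 the generator `s = τ⁻¹(1)` (`hom_app_inv_app_one`, `hom_app_smul_inv_app_one`, `eq_of_smul_inv_app_one_eq`), the
  eigen-relation `exists_actSections_generator_eq_smul`, and: global functions of `A` come from `S` and are fixed by the action
  (`exists_app_eq_of_isLocallyNoetherian`, `appLE_aut_eq_self`);
* §2 the eigenvalue is a CHARACTER: `actSections_mul_generator`, `actSections_one_generator`, `actSections_pow_generator`,
  `pow_eq_one_of_actSections_generator_eq_smul` (`g^n = 1 ⇒ a_g^n = 1`), `isUnit_of_actSections_generator_eq_smul`;
* §3 INDEPENDENCE OF THE TRIVIALISATION: two trivialisations `τ, τ′` of `[n]^* L` have the same eigenvalues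
  (`eigenvalue_eq_of_iso`) — so `a_g` is an invariant `e(g, L)` of `(ρ, L)` alone;
* §4 the eigenvalue as a unit `e(g, L) ∈ Γ(S, 𝒪_S)` for `[n]^* L` trivial: `exists_eigenvalueUnit` (for EVERY trivialisation),
  `eigenvalueUnit_unique`, `eigenvalueUnit_pow_eq_one` (`g^n = 1 ⇒ e^n = 1`), `eigenvalueUnit_mul`, `eigenvalueUnit_one` — the
  relative character pairing of the cell's (h9-S) (W1); its Poincaré instantiation `e_n(σ, c)` (`L = (1 × c)^*𝒫`, trivialised by ★
  (K1) `PoincareSheafMulNKernel`) and base change are the sequel ★-to-be `TorsionSectionPairing`.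

Cell hodgecm-mathlib (D-0151), F-DAG (h9) symplectic half (S2) road (W1) (census `B-provers/B-p13/g18/CENSUS-h9S-LevelTransport`;
B-p03 (g16) 03:13:50Z price fit; B-plan1 (g15) 03:24:17Z).  Count-neutral capital (also brick 1 of the Cartier duality
`A[n] × Â[n] → μ_n` over a base, which F-3/F-6 want); HC_CM is proved only modulo the 7 printed citations until rung 0 closes.

## References
* [MumfordAV1970] D. Mumford, *Abelian Varieties* (1970), §7 Thm. 4 (p. 72), §12 Thm. 1 (p. 112), §15 Thm. 1 (p. 143), §20
  (pp. 183–185, the `e_n`-pairing via the action of `X_n` on `n_X^* L`).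
* [MilneAV2008] J. S. Milne, *Abelian Varieties* (2008), I §11 (the `e_m`-pairing), I §8 (pp. 36–37).
* Tree: ★ `RelativeSpec.ActionOver` (`actSections`, `actSections_smul`, `appLE_aut_app`, `EquivariantStructure.ofPullback`,
  `actSections_ofPullback_one/_mul`, `exists_eq_smul_of_iso_unit`), ★ `AbelianSchemeQuotientMulNDescent` (`mulN`,
  `translation_comp_mulN`, `aut_hom_comp_mulN_left`), ★ `AbelianSchemeSteinOfNoetherian` (`app_bijective_of_isLocallyNoetherian`).
-/

set_option autoImplicit false

noncomputable section

-- `TopCat.Presheaf`/`Scheme.Modules` are not reducible (as in Mathlib's `AlgebraicGeometry/Modules`).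
set_option backward.isDefEq.respectTransparency false

universe u

open CategoryTheory CategoryTheory.Limits AlgebraicGeometry MonoidalCategory CartesianMonoidalCategory TopologicalSpace
  Opposite
open scoped MonObj

namespace Literature.AlgebraicGeometry.AbelianSchemes.AbelianSchemeOver.MulNCharacter

open Literature.AlgebraicGeometry.RelativeSpec Literature.AlgebraicGeometry.Modules Literature.AlgebraicGeometry.Motives
  Literature.AlgebraicGeometry.HodgeTheory Literature.AlgebraicGeometry.Morphisms

variable {S : Scheme.{u}} (A : AbelianSchemeOver S) {K : Type u} [Group K] {n : ℕ}
  (ρ : ActionOver (A.mulN n).left K) (L : A.X.left.Modules)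
  (τ : (Scheme.Modules.pullback (A.mulN n).left).obj L ≅ SheafOfModules.unit _)

/-! ## §1 The generator `s = τ⁻¹(1)` of `[n]^* L`; functions of `A` come from `S` and are fixed -/

/-- `τ(s) = 1` for the generator `s := τ⁻¹(1)` of `[n]^* L`. [cite: MumfordAV1970, §12 Thm. 1 (p. 112)] -/
theorem hom_app_inv_app_one :
    τ.hom.app ((A.mulN n).left ⁻¹ᵁ ⊤)
        (τ.inv.app ((A.mulN n).left ⁻¹ᵁ ⊤) (1 : Γ(A.X.left, (A.mulN n).left ⁻¹ᵁ ⊤))) =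
      (1 : Γ(A.X.left, (A.mulN n).left ⁻¹ᵁ ⊤)) := by
  rw [← CategoryTheory.comp_apply, ← Scheme.Modules.Hom.comp_app, Iso.inv_hom_id, Scheme.Modules.Hom.id_app]
  rfl

/-- `τ(b · s) = b` for the generator `s = τ⁻¹(1)`. [cite: MumfordAV1970, §12 Thm. 1 (p. 112)] -/
theorem hom_app_smul_inv_app_one (b : Γ(A.X.left, (A.mulN n).left ⁻¹ᵁ ⊤)) :
    τ.hom.app ((A.mulN n).left ⁻¹ᵁ ⊤)
        (b • τ.inv.app ((A.mulN n).left ⁻¹ᵁ ⊤) (1 : Γ(A.X.left, (A.mulN n).left ⁻¹ᵁ ⊤))) = b := by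
  rw [Scheme.Modules.Hom.app_smul, hom_app_inv_app_one]
  exact mul_one b

/-- **Coefficients on the generator are unique**: `b · s = b′ · s ⇒ b = b′` (apply `τ`).
[cite: MumfordAV1970, §12 Thm. 1 (p. 112)] -/
theorem eq_of_smul_inv_app_one_eq (b b' : Γ(A.X.left, (A.mulN n).left ⁻¹ᵁ ⊤))
    (h : b • τ.inv.app ((A.mulN n).left ⁻¹ᵁ ⊤) (1 : Γ(A.X.left, (A.mulN n).left ⁻¹ᵁ ⊤)) =
      b' • τ.inv.app ((A.mulN n).left ⁻¹ᵁ ⊤) (1 : Γ(A.X.left, (A.mulN n).left ⁻¹ᵁ ⊤))) : b = b' := by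
  have h' := congrArg (fun t => τ.hom.app ((A.mulN n).left ⁻¹ᵁ ⊤) t) h
  simp only at h'
  rwa [hom_app_smul_inv_app_one A L τ, hom_app_smul_inv_app_one A L τ] at h'

/-- **The generator `s = τ⁻¹(1)` is an eigen-section of every `g ∈ K`** for the canonical linearisation of `[n]^* L`:
`g · s = a · s` for some global function `a` of `A` (★ `exists_eq_smul_of_iso_unit`). [MumfordAV1970] §20 p. 184: the
translations by `X_n` act on `n_X^* L ≅ 𝒪` through scalars. [cite: MumfordAV1970, §20 (p. 184)] [cite: MumfordAV1970, §12 Thm. 1 (p. 112)] -/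
theorem exists_actSections_generator_eq_smul (g : K) :
    ∃ a : Γ(A.X.left, (A.mulN n).left ⁻¹ᵁ ⊤),
      ρ.actSections _ (ActionOver.EquivariantStructure.ofPullback ρ L).iso g ⊤
          (τ.inv.app ((A.mulN n).left ⁻¹ᵁ ⊤) (1 : Γ(A.X.left, (A.mulN n).left ⁻¹ᵁ ⊤))) =
        a • τ.inv.app ((A.mulN n).left ⁻¹ᵁ ⊤) (1 : Γ(A.X.left, (A.mulN n).left ⁻¹ᵁ ⊤)) :=
  ActionOver.exists_eq_smul_of_iso_unit _ τ _ (by rw [hom_app_inv_app_one]; exact isUnit_one) _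

/-- **Global functions of `A` come from `S`** (Stein for abelian schemes over a locally Noetherian base, ★
`app_bijective_of_isLocallyNoetherian`), in the spelling over `[n]⁻¹ A = A`: every `b ∈ Γ(A, 𝒪)` is `π^♯ c`, i.e.
`[n]^♯ (π^♯ c)` since `[n] ≫ π = π`. [cite: GortzWedhorn2023, Cor. 24.63 (p. 404)] -/
theorem exists_app_eq_of_isLocallyNoetherian [IsLocallyNoetherian S] (b : Γ(A.X.left, (A.mulN n).left ⁻¹ᵁ ⊤)) :
    ∃ c : Γ(S, ⊤), b = (A.mulN n).left.appTop (A.X.hom.appTop c) := by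
  obtain ⟨c, hc⟩ := (A.app_bijective_of_isLocallyNoetherian ⊤).2 (show Γ(A.X.left, A.X.hom ⁻¹ᵁ ⊤) from b)
  refine ⟨c, ?_⟩
  have hw : (A.mulN n).left ≫ A.X.hom = A.X.hom := Over.w (A.mulN n)
  change b = (A.X.hom.appTop ≫ (A.mulN n).left.appTop) c
  rw [← Scheme.Hom.comp_appTop, hw]
  exact hc.symm

/-- **The action fixes the global functions of `A`**: `σ_g^♯ b = b` for every `b ∈ Γ(A, 𝒪)` (they come from `S`, hence from `A`
along `[n]`, and such functions are fixed, ★ `appLE_aut_app`). [cite: MumfordAV1970, §12 Thm. 1 (p. 112)] -/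
theorem appLE_aut_eq_self [IsLocallyNoetherian S] (g : K) (b : Γ(A.X.left, (A.mulN n).left ⁻¹ᵁ ⊤)) :
    (ρ.aut g).hom.appLE ((A.mulN n).left ⁻¹ᵁ ⊤) ((A.mulN n).left ⁻¹ᵁ ⊤) (ρ.preimage_preimage g ⊤).ge b = b := by
  obtain ⟨c, hc⟩ := exists_app_eq_of_isLocallyNoetherian A b
  rw [hc]
  exact ρ.appLE_aut_app g ⊤ _

/-! ## §2 The eigenvalue is a character -/

/-- **The eigen-relation is multiplicative**: `g · s = a s`, `h · s = b s ⇒ (gh) · s = (a b) s` — the cocycle condition for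
the TRIVIAL action of `K` on `Γ(A, 𝒪) = Γ(S, 𝒪)`. [cite: MumfordAV1970, §20 (p. 184)] [cite: MumfordAV1970, §15 Thm. 1 (p. 143)] -/
theorem actSections_mul_generator [IsLocallyNoetherian S] (g h : K) (a b : Γ(A.X.left, (A.mulN n).left ⁻¹ᵁ ⊤))
    (ha : ρ.actSections _ (ActionOver.EquivariantStructure.ofPullback ρ L).iso g ⊤
        (τ.inv.app ((A.mulN n).left ⁻¹ᵁ ⊤) (1 : Γ(A.X.left, (A.mulN n).left ⁻¹ᵁ ⊤))) =
      a • τ.inv.app ((A.mulN n).left ⁻¹ᵁ ⊤) (1 : Γ(A.X.left, (A.mulN n).left ⁻¹ᵁ ⊤)))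
    (hb : ρ.actSections _ (ActionOver.EquivariantStructure.ofPullback ρ L).iso h ⊤
        (τ.inv.app ((A.mulN n).left ⁻¹ᵁ ⊤) (1 : Γ(A.X.left, (A.mulN n).left ⁻¹ᵁ ⊤))) =
      b • τ.inv.app ((A.mulN n).left ⁻¹ᵁ ⊤) (1 : Γ(A.X.left, (A.mulN n).left ⁻¹ᵁ ⊤))) :
    ρ.actSections _ (ActionOver.EquivariantStructure.ofPullback ρ L).iso (g * h) ⊤
        (τ.inv.app ((A.mulN n).left ⁻¹ᵁ ⊤) (1 : Γ(A.X.left, (A.mulN n).left ⁻¹ᵁ ⊤))) =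
      (a * b) • τ.inv.app ((A.mulN n).left ⁻¹ᵁ ⊤) (1 : Γ(A.X.left, (A.mulN n).left ⁻¹ᵁ ⊤)) := by
  rw [ρ.actSections_ofPullback_mul, ha, ActionOver.actSections_smul, appLE_aut_eq_self A ρ, hb, ← mul_smul]

/-- `1 · s = s`. [cite: MumfordAV1970, §12 Thm. 1 (p. 112)] -/
theorem actSections_one_generator :
    ρ.actSections _ (ActionOver.EquivariantStructure.ofPullback ρ L).iso 1 ⊤
        (τ.inv.app ((A.mulN n).left ⁻¹ᵁ ⊤) (1 : Γ(A.X.left, (A.mulN n).left ⁻¹ᵁ ⊤))) =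
      τ.inv.app ((A.mulN n).left ⁻¹ᵁ ⊤) (1 : Γ(A.X.left, (A.mulN n).left ⁻¹ᵁ ⊤)) :=
  ρ.actSections_ofPullback_one L ⊤ _

/-- Powers of the eigen-relation: `g · s = a s ⇒ g^m · s = a^m s`. [cite: MumfordAV1970, §20 (p. 184)] -/
theorem actSections_pow_generator [IsLocallyNoetherian S] (g : K) (a : Γ(A.X.left, (A.mulN n).left ⁻¹ᵁ ⊤))
    (ha : ρ.actSections _ (ActionOver.EquivariantStructure.ofPullback ρ L).iso g ⊤
        (τ.inv.app ((A.mulN n).left ⁻¹ᵁ ⊤) (1 : Γ(A.X.left, (A.mulN n).left ⁻¹ᵁ ⊤))) =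
      a • τ.inv.app ((A.mulN n).left ⁻¹ᵁ ⊤) (1 : Γ(A.X.left, (A.mulN n).left ⁻¹ᵁ ⊤)))
    (m : ℕ) :
    ρ.actSections _ (ActionOver.EquivariantStructure.ofPullback ρ L).iso (g ^ m) ⊤
        (τ.inv.app ((A.mulN n).left ⁻¹ᵁ ⊤) (1 : Γ(A.X.left, (A.mulN n).left ⁻¹ᵁ ⊤))) =
      (a ^ m) • τ.inv.app ((A.mulN n).left ⁻¹ᵁ ⊤) (1 : Γ(A.X.left, (A.mulN n).left ⁻¹ᵁ ⊤)) := by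
  induction m with
  | zero => rw [pow_zero, pow_zero, one_smul]; exact actSections_one_generator A ρ L τ
  | succ m ih => rw [pow_succ, pow_succ, actSections_mul_generator A ρ L τ (g ^ m) g _ _ ih ha]

/-- **The eigenvalue of an element killed by `n` is an `n`-th root of unity**: `g · s = a s` with `g ^ n = 1 ⇒ a ^ n = 1`
(`s = g^n · s = a^n s`, and `s` generates).  For the translations by `n`-torsion sections this is «`e_n(σ, c) ∈ μ_n`».
[cite: MumfordAV1970, §20 (p. 184)] [cite: MumfordAV1970, §15 Thm. 1 (p. 143)] -/
theorem pow_eq_one_of_actSections_generator_eq_smul [IsLocallyNoetherian S] (g : K) (hg : g ^ n = 1)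
    (a : Γ(A.X.left, (A.mulN n).left ⁻¹ᵁ ⊤))
    (ha : ρ.actSections _ (ActionOver.EquivariantStructure.ofPullback ρ L).iso g ⊤
        (τ.inv.app ((A.mulN n).left ⁻¹ᵁ ⊤) (1 : Γ(A.X.left, (A.mulN n).left ⁻¹ᵁ ⊤))) =
      a • τ.inv.app ((A.mulN n).left ⁻¹ᵁ ⊤) (1 : Γ(A.X.left, (A.mulN n).left ⁻¹ᵁ ⊤))) :
    a ^ n = 1 := by
  have h := actSections_pow_generator A ρ L τ g a ha n
  rw [hg, actSections_one_generator A ρ L τ] at h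
  have h' := eq_of_smul_inv_app_one_eq A L τ 1 (a ^ n) (by rw [one_smul]; exact h)
  exact h'.symm

/-- The eigenvalue of an element killed by `n ≠ 0` is a unit of `Γ(A, 𝒪)`. [cite: MumfordAV1970, §20 (p. 184)] -/
theorem isUnit_of_actSections_generator_eq_smul [IsLocallyNoetherian S] (hn : n ≠ 0) (g : K) (hg : g ^ n = 1)
    (a : Γ(A.X.left, (A.mulN n).left ⁻¹ᵁ ⊤))
    (ha : ρ.actSections _ (ActionOver.EquivariantStructure.ofPullback ρ L).iso g ⊤
        (τ.inv.app ((A.mulN n).left ⁻¹ᵁ ⊤) (1 : Γ(A.X.left, (A.mulN n).left ⁻¹ᵁ ⊤))) =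
      a • τ.inv.app ((A.mulN n).left ⁻¹ᵁ ⊤) (1 : Γ(A.X.left, (A.mulN n).left ⁻¹ᵁ ⊤))) :
    IsUnit a :=
  IsUnit.of_pow_eq_one (pow_eq_one_of_actSections_generator_eq_smul A ρ L τ g hg a ha) hn

/-- **The eigenvalue lies in `Γ(S, 𝒪_S)`**: `a = [n]^♯ π^♯ c` for some `c` (Stein). [cite: GortzWedhorn2023, Cor. 24.63 (p. 404)] -/
theorem exists_eigenvalue_eq_app [IsLocallyNoetherian S] (g : K) :
    ∃ (c : Γ(S, ⊤)),
      ρ.actSections _ (ActionOver.EquivariantStructure.ofPullback ρ L).iso g ⊤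
          (τ.inv.app ((A.mulN n).left ⁻¹ᵁ ⊤) (1 : Γ(A.X.left, (A.mulN n).left ⁻¹ᵁ ⊤))) =
        (show Γ(A.X.left, (A.mulN n).left ⁻¹ᵁ ⊤) from (A.mulN n).left.appTop (A.X.hom.appTop c)) •
          τ.inv.app ((A.mulN n).left ⁻¹ᵁ ⊤) (1 : Γ(A.X.left, (A.mulN n).left ⁻¹ᵁ ⊤)) := by
  obtain ⟨a, ha⟩ := exists_actSections_generator_eq_smul A ρ L τ g
  obtain ⟨c, hc⟩ := exists_app_eq_of_isLocallyNoetherian A a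
  exact ⟨c, hc ▸ ha⟩

/-! ## §3 Independence of the trivialisation -/

/-- **Two trivialisations of `[n]^* L` differ by a global function**: `τ′⁻¹(1) = b · τ⁻¹(1)`.
[cite: MumfordAV1970, §12 Thm. 1 (p. 112)] -/
theorem exists_inv_app_one_eq_smul (τ' : (Scheme.Modules.pullback (A.mulN n).left).obj L ≅ SheafOfModules.unit _) :
    ∃ b : Γ(A.X.left, (A.mulN n).left ⁻¹ᵁ ⊤),
      τ'.inv.app ((A.mulN n).left ⁻¹ᵁ ⊤) (1 : Γ(A.X.left, (A.mulN n).left ⁻¹ᵁ ⊤)) =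
        b • τ.inv.app ((A.mulN n).left ⁻¹ᵁ ⊤) (1 : Γ(A.X.left, (A.mulN n).left ⁻¹ᵁ ⊤)) :=
  ActionOver.exists_eq_smul_of_iso_unit _ τ _ (by rw [hom_app_inv_app_one]; exact isUnit_one) _

/-- **INDEPENDENCE OF THE TRIVIALISATION**: the eigenvalues of `g` on the generators `τ⁻¹(1)` and `τ′⁻¹(1)` of two
trivialisations of `[n]^* L` COINCIDE (`τ′⁻¹(1) = b · τ⁻¹(1)` with `b` fixed by the action, §1).  So the eigenvalue is an
invariant of `(ρ, g, L)` — the relative character pairing. [cite: MumfordAV1970, §20 (p. 184)] [cite: MilneAV2008, I §11] -/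
theorem eigenvalue_eq_of_iso [IsLocallyNoetherian S]
    (τ' : (Scheme.Modules.pullback (A.mulN n).left).obj L ≅ SheafOfModules.unit _) (g : K)
    (a a' : Γ(A.X.left, (A.mulN n).left ⁻¹ᵁ ⊤))
    (ha : ρ.actSections _ (ActionOver.EquivariantStructure.ofPullback ρ L).iso g ⊤
        (τ.inv.app ((A.mulN n).left ⁻¹ᵁ ⊤) (1 : Γ(A.X.left, (A.mulN n).left ⁻¹ᵁ ⊤))) =
      a • τ.inv.app ((A.mulN n).left ⁻¹ᵁ ⊤) (1 : Γ(A.X.left, (A.mulN n).left ⁻¹ᵁ ⊤)))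
    (ha' : ρ.actSections _ (ActionOver.EquivariantStructure.ofPullback ρ L).iso g ⊤
        (τ'.inv.app ((A.mulN n).left ⁻¹ᵁ ⊤) (1 : Γ(A.X.left, (A.mulN n).left ⁻¹ᵁ ⊤))) =
      a' • τ'.inv.app ((A.mulN n).left ⁻¹ᵁ ⊤) (1 : Γ(A.X.left, (A.mulN n).left ⁻¹ᵁ ⊤))) :
    a = a' := by
  obtain ⟨b, hb⟩ := exists_inv_app_one_eq_smul A L τ τ'
  -- `g · s′ = g · (b s) = b (g · s) = (b a) s` and `g · s′ = a′ s′ = (a′ b) s`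
  rw [hb, ActionOver.actSections_smul, appLE_aut_eq_self A ρ, ha, ← mul_smul, ← mul_smul] at ha'
  have h2 := eq_of_smul_inv_app_one_eq A L τ _ _ ha'
  -- `b` is a unit: `τ⁻¹(1) = b′ τ′⁻¹(1) = (b′ b) τ⁻¹(1)`
  obtain ⟨b', hb'⟩ := exists_inv_app_one_eq_smul A L τ' τ
  have hbb : b' * b = 1 := by
    rw [hb, ← mul_smul] at hb'
    exact (eq_of_smul_inv_app_one_eq A L τ 1 (b' * b) (by rw [one_smul]; exact hb')).symm
  calc a = b' * b * a := by rw [hbb, one_mul]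
    _ = b' * (b * a) := by ring
    _ = b' * (a' * b) := by rw [h2]
    _ = b' * b * a' := by ring
    _ = a' := by rw [hbb, one_mul]

/-! ## §4 The eigenvalue as a unit of `Γ(S, 𝒪_S)`: existence and uniqueness, independent of the trivialisation -/

/-- **Stein injectivity in the `[n]`-spelling**: `c ↦ [n]^♯ π^♯ c`, `Γ(S, 𝒪) → Γ(A, 𝒪)`, is injective.
[cite: GortzWedhorn2023, Cor. 24.63 (p. 404)] -/
theorem appTop_appTop_injective [IsLocallyNoetherian S] :
    Function.Injective fun c : Γ(S, ⊤) => (A.mulN n).left.appTop (A.X.hom.appTop c) := by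
  have hw : (A.mulN n).left ≫ A.X.hom = A.X.hom := Over.w (A.mulN n)
  intro c c' h
  apply (A.app_bijective_of_isLocallyNoetherian ⊤).1
  change (A.X.hom.appTop) c = (A.X.hom.appTop) c'
  rw [← hw, Scheme.Hom.comp_appTop]
  exact h

/-- **THE EIGENVALUE AS A UNIT OF THE BASE — existence**: if `[n]^* L` is trivial, then for every `g ∈ K` there is
`e ∈ Γ(S, 𝒪_S)` such that `g · τ⁻¹(1) = ([n]^♯ π^♯ e) · τ⁻¹(1)` for EVERY trivialisation `τ` of `[n]^* L` (§3: the eigenvalue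
does not depend on `τ`; §1: it comes from `S`).  This `e = e(g, L)` is the relative character pairing ([MumfordAV1970] §20
p. 184 for `L ∈ Pic⁰` of order `n` and `g` a translation by an `n`-torsion point). [cite: MumfordAV1970, §20 (p. 184)] -/
theorem exists_eigenvalueUnit [IsLocallyNoetherian S]
    (hL : Nonempty ((Scheme.Modules.pullback (A.mulN n).left).obj L ≅ SheafOfModules.unit _)) (g : K) :
    ∃ e : Γ(S, ⊤), ∀ τ : (Scheme.Modules.pullback (A.mulN n).left).obj L ≅ SheafOfModules.unit _,
      ρ.actSections _ (ActionOver.EquivariantStructure.ofPullback ρ L).iso g ⊤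
          (τ.inv.app ((A.mulN n).left ⁻¹ᵁ ⊤) (1 : Γ(A.X.left, (A.mulN n).left ⁻¹ᵁ ⊤))) =
        (show Γ(A.X.left, (A.mulN n).left ⁻¹ᵁ ⊤) from (A.mulN n).left.appTop (A.X.hom.appTop e)) •
          τ.inv.app ((A.mulN n).left ⁻¹ᵁ ⊤) (1 : Γ(A.X.left, (A.mulN n).left ⁻¹ᵁ ⊤)) := by
  obtain ⟨τ₀⟩ := hL
  obtain ⟨e, he⟩ := exists_eigenvalue_eq_app A ρ L τ₀ g
  refine ⟨e, fun τ => ?_⟩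
  obtain ⟨a, ha⟩ := exists_actSections_generator_eq_smul A ρ L τ g
  rw [ha, ← eigenvalue_eq_of_iso A ρ L τ₀ τ g _ a he ha]

/-- **THE EIGENVALUE AS A UNIT OF THE BASE — uniqueness**: two elements of `Γ(S, 𝒪_S)` with the eigen-relation for SOME
trivialisation each are equal (§3 + coefficient uniqueness + Stein injectivity). [cite: MumfordAV1970, §20 (p. 184)] -/
theorem eigenvalueUnit_unique [IsLocallyNoetherian S]
    (τ τ' : (Scheme.Modules.pullback (A.mulN n).left).obj L ≅ SheafOfModules.unit _) (g : K) (e e' : Γ(S, ⊤))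
    (he : ρ.actSections _ (ActionOver.EquivariantStructure.ofPullback ρ L).iso g ⊤
          (τ.inv.app ((A.mulN n).left ⁻¹ᵁ ⊤) (1 : Γ(A.X.left, (A.mulN n).left ⁻¹ᵁ ⊤))) =
        (show Γ(A.X.left, (A.mulN n).left ⁻¹ᵁ ⊤) from (A.mulN n).left.appTop (A.X.hom.appTop e)) •
          τ.inv.app ((A.mulN n).left ⁻¹ᵁ ⊤) (1 : Γ(A.X.left, (A.mulN n).left ⁻¹ᵁ ⊤)))
    (he' : ρ.actSections _ (ActionOver.EquivariantStructure.ofPullback ρ L).iso g ⊤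
          (τ'.inv.app ((A.mulN n).left ⁻¹ᵁ ⊤) (1 : Γ(A.X.left, (A.mulN n).left ⁻¹ᵁ ⊤))) =
        (show Γ(A.X.left, (A.mulN n).left ⁻¹ᵁ ⊤) from (A.mulN n).left.appTop (A.X.hom.appTop e')) •
          τ'.inv.app ((A.mulN n).left ⁻¹ᵁ ⊤) (1 : Γ(A.X.left, (A.mulN n).left ⁻¹ᵁ ⊤))) :
    e = e' :=
  appTop_appTop_injective A (eigenvalue_eq_of_iso A ρ L τ τ' g _ _ he he')

/-- **`e(g, L)^n = 1` for `g^n = 1`** (§2 pushed down to `S` by Stein injectivity). [cite: MumfordAV1970, §20 (p. 184)] -/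
theorem eigenvalueUnit_pow_eq_one [IsLocallyNoetherian S]
    (τ : (Scheme.Modules.pullback (A.mulN n).left).obj L ≅ SheafOfModules.unit _) (g : K) (hg : g ^ n = 1) (e : Γ(S, ⊤))
    (he : ρ.actSections _ (ActionOver.EquivariantStructure.ofPullback ρ L).iso g ⊤
          (τ.inv.app ((A.mulN n).left ⁻¹ᵁ ⊤) (1 : Γ(A.X.left, (A.mulN n).left ⁻¹ᵁ ⊤))) =
        (show Γ(A.X.left, (A.mulN n).left ⁻¹ᵁ ⊤) from (A.mulN n).left.appTop (A.X.hom.appTop e)) •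
          τ.inv.app ((A.mulN n).left ⁻¹ᵁ ⊤) (1 : Γ(A.X.left, (A.mulN n).left ⁻¹ᵁ ⊤))) :
    e ^ n = 1 := by
  have h := pow_eq_one_of_actSections_generator_eq_smul A ρ L τ g hg _ he
  apply appTop_appTop_injective A (n := n)
  change (A.mulN n).left.appTop (A.X.hom.appTop (e ^ n)) = (A.mulN n).left.appTop (A.X.hom.appTop 1)
  rw [map_pow, map_pow, map_one, map_one]
  exact h

/-- **`e(gh, L) = e(g, L) · e(h, L)`** — the relative character pairing is a homomorphism `K → Γ(S, 𝒪_S)^×` (§2 pushed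
down to `S`). [cite: MumfordAV1970, §20 (p. 184)] -/
theorem eigenvalueUnit_mul [IsLocallyNoetherian S]
    (τ : (Scheme.Modules.pullback (A.mulN n).left).obj L ≅ SheafOfModules.unit _) (g h : K) (e e' e'' : Γ(S, ⊤))
    (he : ρ.actSections _ (ActionOver.EquivariantStructure.ofPullback ρ L).iso g ⊤
          (τ.inv.app ((A.mulN n).left ⁻¹ᵁ ⊤) (1 : Γ(A.X.left, (A.mulN n).left ⁻¹ᵁ ⊤))) =
        (show Γ(A.X.left, (A.mulN n).left ⁻¹ᵁ ⊤) from (A.mulN n).left.appTop (A.X.hom.appTop e)) •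
          τ.inv.app ((A.mulN n).left ⁻¹ᵁ ⊤) (1 : Γ(A.X.left, (A.mulN n).left ⁻¹ᵁ ⊤)))
    (he' : ρ.actSections _ (ActionOver.EquivariantStructure.ofPullback ρ L).iso h ⊤
          (τ.inv.app ((A.mulN n).left ⁻¹ᵁ ⊤) (1 : Γ(A.X.left, (A.mulN n).left ⁻¹ᵁ ⊤))) =
        (show Γ(A.X.left, (A.mulN n).left ⁻¹ᵁ ⊤) from (A.mulN n).left.appTop (A.X.hom.appTop e')) •
          τ.inv.app ((A.mulN n).left ⁻¹ᵁ ⊤) (1 : Γ(A.X.left, (A.mulN n).left ⁻¹ᵁ ⊤)))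
    (he'' : ρ.actSections _ (ActionOver.EquivariantStructure.ofPullback ρ L).iso (g * h) ⊤
          (τ.inv.app ((A.mulN n).left ⁻¹ᵁ ⊤) (1 : Γ(A.X.left, (A.mulN n).left ⁻¹ᵁ ⊤))) =
        (show Γ(A.X.left, (A.mulN n).left ⁻¹ᵁ ⊤) from (A.mulN n).left.appTop (A.X.hom.appTop e'')) •
          τ.inv.app ((A.mulN n).left ⁻¹ᵁ ⊤) (1 : Γ(A.X.left, (A.mulN n).left ⁻¹ᵁ ⊤))) :
    e'' = e * e' := by
  have hmul := actSections_mul_generator A ρ L τ g h _ _ he he'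
  have hcoef := eq_of_smul_inv_app_one_eq A L τ _ _ (he''.symm.trans hmul)
  apply appTop_appTop_injective A (n := n)
  change (A.mulN n).left.appTop (A.X.hom.appTop e'') = (A.mulN n).left.appTop (A.X.hom.appTop (e * e'))
  rw [map_mul, map_mul]
  exact hcoef

/-- **`e(1, L) = 1`**. [cite: MumfordAV1970, §20 (p. 184)] -/
theorem eigenvalueUnit_one [IsLocallyNoetherian S]
    (τ : (Scheme.Modules.pullback (A.mulN n).left).obj L ≅ SheafOfModules.unit _) (e : Γ(S, ⊤))
    (he : ρ.actSections _ (ActionOver.EquivariantStructure.ofPullback ρ L).iso 1 ⊤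
          (τ.inv.app ((A.mulN n).left ⁻¹ᵁ ⊤) (1 : Γ(A.X.left, (A.mulN n).left ⁻¹ᵁ ⊤))) =
        (show Γ(A.X.left, (A.mulN n).left ⁻¹ᵁ ⊤) from (A.mulN n).left.appTop (A.X.hom.appTop e)) •
          τ.inv.app ((A.mulN n).left ⁻¹ᵁ ⊤) (1 : Γ(A.X.left, (A.mulN n).left ⁻¹ᵁ ⊤))) :
    e = 1 := by
  have h1 := actSections_one_generator A ρ L τ
  have hcoef := eq_of_smul_inv_app_one_eq A L τ _ 1 (he.symm.trans (h1.trans (one_smul _ _).symm))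
  apply appTop_appTop_injective A (n := n)
  change (A.mulN n).left.appTop (A.X.hom.appTop e) = (A.mulN n).left.appTop (A.X.hom.appTop 1)
  rw [map_one, map_one]
  exact hcoef

end Literature.AlgebraicGeometry.AbelianSchemes.AbelianSchemeOver.MulNCharacter

end
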